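import Summits.ResolutionOfSingularities.ResolutionOfSingularities.Theorems.FrobeniusClosingSteerEtaleResidueLiftMaps
import Summits.ResolutionOfSingularities.ResolutionOfSingularities.Theorems.FrobeniusClosingSteerQuadraticTransformResiduallyFinite
import Literature.AlgebraicGeometry.Resolution.RegularLocalRingsProofs
import Literature.AlgebraicGeometry.Resolution.QuadraticTransforms
import HarnessLib

/-!
# [OURS · L0 W4.1] K3-a part 4, stage B2a: TWO LEVELS of the window — the local map `T_S → T_{S′}` and the nested ranges in a field
# (chain W4.1 `FrobeniusClosingSteer`, crux stmt-ResolutionOfSingularities-16345; K3 route (R1), RULINGs 250(a)/258; interface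
# `D/res-D-lib-1/K3WindowInterface.lean` 1dc250035b4b213c; `--supports … --as helper`)

HONEST FRAMING. OURS kernel (HIRONAKA-L librarian res-D-lib-1 gen 7). For local subrings `S ≤ S′` of a field `L` with `S′` dominating `S`, a monic `P ∈ S[X]`,
`φ′ : κ(S′) → k′`, `θ ∈ k′` a root of `P` through `κ(S) → κ(S′) → k′`: with `A := S[X]/(P)`, `A′ := S′[X]/(P)`, `ι : A → A′` the change of rings,
`𝔫 ⊂ A`, `𝔫′ ⊂ A′` the kernels towards `k′`, `T := A_𝔫`, `T′ := A′_𝔫′`: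
* `eval₂_inclusion_of_eval₂` — the root relation downstairs from the one upstairs; `ker_lift_eq_comap` — **`𝔫 = ι⁻¹ 𝔫′`**;
* `liftHom` facts: the induced LOCAL map `g : T → T′` (`Localization.localRingHom`), `g ∘ (A → T) = (A′ → T′) ∘ ι`, `g(x) = x′`;
* `injective_algebraMap_localization_ker_lift` — `S′ → T′` is injective (faithful flatness); **`injective_liftHom`** — `g` is INJECTIVE when `S, S′` are regular
  (both localisations are domains; `…EtaleResidueLiftMaps.localization_map_injective`);
* in a field `L′` with `j′ : T′ → L′` injective and `j := j′ ∘ g`: `range_comp_le` (`j.range ≤ j′.range`), **`subringDominates_range_comp`**; and in `T′`: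
  `liftHom_algebraMap` (the squares `g(s) = incl s`) and `liftHom_root` (`g(x) = x′`).
Nothing here is a statement of H. Hironaka's manuscript [Hironaka2017]. AI-written; AI review is weaker than expert review. [cite: StacksProject, Tag 00TV]
-/

set_option linter.dupNamespace false

noncomputable section

namespace Summit.ResolutionOfSingularities.ResolutionOfSingularities.Theorems.SwitchingDichotomy.EtaleLift

open IsLocalRing Polynomial Literature.AlgebraicGeometry.Resolution

/-- `S′ → T′ := (S′[X]/(P))_𝔫′` is injective (faithful flatness). [folklore] -/
theorem injective_algebraMap_localization_ker_lift {R : Type} [CommRing R] [IsLocalRing R] (Q : R[X]) {k : Type} [Field k]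
    (ψ : ResidueField R →+* k) (t : k) (ht : Q.eval₂ (ψ.comp (residue R)) t = 0) (hQ : Q.Monic) :
    haveI := isMaximal_ker_lift Q ψ t ht hQ
    Function.Injective (algebraMap R (Localization.AtPrime (RingHom.ker (AdjoinRoot.lift (ψ.comp (residue R)) t ht)))) := by
  haveI := isMaximal_ker_lift Q ψ t ht hQ
  haveI := faithfullyFlat_localization_ker_lift Q ψ t ht hQ
  rw [RingHom.injective_iff_ker_eq_bot, RingHom.ker_eq_comap_bot, ← Ideal.map_bot (f := algebraMap R _)]
  exact Ideal.comap_map_eq_self_of_faithfullyFlat ⊥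


/-! ## Nested ranges in a field -/

/-- `range (j′ ∘ g) ≤ range j′`. [folklore] -/
theorem range_comp_le {T T' L' : Type} [CommRing T] [CommRing T'] [Field L'] (g : T →+* T') (j' : T' →+* L') :
    (j'.comp g).range ≤ j'.range := by
  rintro x ⟨t, rfl⟩
  exact ⟨g t, rfl⟩

/-- **Dominance of nested ranges**: for a LOCAL map `g : T → T′` of local rings and an injective `j′ : T′ → L′`, `range j′` dominates `range (j′ ∘ g)`:
an element of the small range which is invertible in the big range is invertible in the small range. [folklore] -/
theorem subringDominates_range_comp {T T' L' : Type} [CommRing T] [CommRing T'] [IsLocalRing T] [IsLocalRing T'] [Field L']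
    (g : T →+* T') [IsLocalHom g] (j' : T' →+* L') (hj' : Function.Injective j') :
    SubringDominates (j'.comp g).range j'.range := by
  refine ⟨range_comp_le g j', ?_⟩
  rintro x ⟨t, rfl⟩ ⟨t'', ht''⟩
  by_cases hx : (j'.comp g) t = 0
  · rw [hx, inv_zero]
    exact Subring.zero_mem _
  have hmul : j' (g t * t'') = 1 := by
    rw [map_mul, ht'']
    exact mul_inv_cancel₀ hx
  have hunit' : IsUnit (g t) := IsUnit.of_mul_eq_one t'' (hj' (by rw [hmul, map_one]))
  obtain ⟨u, hu⟩ := isUnit_of_map_unit g t hunit'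
  refine ⟨(↑u⁻¹ : T), ?_⟩
  have h1 : (j'.comp g) (↑u⁻¹ : T) * (j'.comp g) t = 1 := by
    rw [← map_mul, ← hu, Units.inv_mul, map_one]
  rw [inv_eq_of_mul_eq_one_left h1]

section TwoLevels

variable {L : Type} [Field L] {S S' : Subring L} [IsLocalRing S] [IsLocalRing S'] (hd : SubringDominates S S')
  (P : S[X]) {k' : Type} [Field k'] (φ' : ResidueField S' →+* k') (θ : k')
  (hθ' : (P.map (Subring.inclusion hd.1)).eval₂ (φ'.comp (residue S')) θ = 0)

include hθ'

/-- The root relation downstairs: `P(θ) = 0` through `κ(S) → κ(S′) → k′`. [folklore] -/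
theorem eval₂_inclusion_of_eval₂ :
    haveI := isLocalHom_inclusion_of_subringDominates hd
    P.eval₂ ((φ'.comp (ResidueField.map (Subring.inclusion hd.1))).comp (residue S)) θ = 0 := by
  haveI := isLocalHom_inclusion_of_subringDominates hd
  have hcomp : (φ'.comp (ResidueField.map (Subring.inclusion hd.1))).comp (residue S) =
      (φ'.comp (residue S')).comp (Subring.inclusion hd.1) := by
    ext s
    change φ' (ResidueField.map (Subring.inclusion hd.1) (residue S s)) = φ' (residue S' (Subring.inclusion hd.1 s))
    rw [ResidueField.map_residue]
  rw [hcomp, ← Polynomial.eval₂_map]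
  exact hθ'

/-- **`𝔫 = ι⁻¹ 𝔫′`**: the kernel towards `k′` downstairs is the pull-back of the kernel upstairs along the change of rings `ι : S[X]/(P) → S′[X]/(P)`.
[folklore] -/
theorem ker_lift_eq_comap :
    haveI := isLocalHom_inclusion_of_subringDominates hd
    RingHom.ker (AdjoinRoot.lift ((φ'.comp (ResidueField.map (Subring.inclusion hd.1))).comp (residue S)) θ
        (eval₂_inclusion_of_eval₂ hd P φ' θ hθ')) =
      (RingHom.ker (AdjoinRoot.lift (φ'.comp (residue S')) θ hθ')).comap
        (AdjoinRoot.lift ((AdjoinRoot.of (P.map (Subring.inclusion hd.1))).comp (Subring.inclusion hd.1))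
          (AdjoinRoot.root (P.map (Subring.inclusion hd.1))) (eval₂_root_map_eq_zero (Subring.inclusion hd.1) P)) := by
  haveI := isLocalHom_inclusion_of_subringDominates hd
  have hfun : (φ'.comp (ResidueField.map (Subring.inclusion hd.1))).comp (residue S) =
      (φ'.comp (residue S')).comp (Subring.inclusion hd.1) := by
    ext s
    change φ' (ResidueField.map (Subring.inclusion hd.1) (residue S s)) = φ' (residue S' (Subring.inclusion hd.1 s))
    rw [ResidueField.map_residue]
  rw [RingHom.comap_ker]
  congr 1
  refine RingHom.ext fun a => ?_
  obtain ⟨q, rfl⟩ := AdjoinRoot.mk_surjective a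
  rw [AdjoinRoot.lift_mk, RingHom.comp_apply, lift_mk_eq_mk_map, AdjoinRoot.lift_mk, Polynomial.eval₂_map, hfun]

/-- **Any map `g : T → T′` over the change of rings is INJECTIVE** when `S` and `S′` are regular (both localisations are regular local DOMAINS;
`…EtaleResidueLiftMaps.localization_map_injective`). Here `T` is taken at the pulled-back prime `ι⁻¹ 𝔫′` (`= 𝔫` by `ker_lift_eq_comap`); the window
uses `g := Localization.localRingHom (ι⁻¹ 𝔫′) 𝔫′ ι rfl`. [cite: StacksProject, Tag 00TV] -/
theorem injective_liftHom (hreg : IsRegularLocalRing S) (hreg' : IsRegularLocalRing S') (hP : P.Monic)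
    (hsep : (P.map (residue S)).Separable)
    (g : (haveI := isMaximal_ker_lift (P.map (Subring.inclusion hd.1)) φ' θ hθ' (hP.map _)
      Localization.AtPrime ((RingHom.ker (AdjoinRoot.lift (φ'.comp (residue S')) θ hθ')).comap
        (AdjoinRoot.lift ((AdjoinRoot.of (P.map (Subring.inclusion hd.1))).comp (Subring.inclusion hd.1))
          (AdjoinRoot.root (P.map (Subring.inclusion hd.1))) (eval₂_root_map_eq_zero (Subring.inclusion hd.1) P)))) →+*
      (haveI := isMaximal_ker_lift (P.map (Subring.inclusion hd.1)) φ' θ hθ' (hP.map _)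
      Localization.AtPrime (RingHom.ker (AdjoinRoot.lift (φ'.comp (residue S')) θ hθ'))))
    (hg : (haveI := isMaximal_ker_lift (P.map (Subring.inclusion hd.1)) φ' θ hθ' (hP.map _)
      g.comp (algebraMap (AdjoinRoot P) _) = (algebraMap (AdjoinRoot (P.map (Subring.inclusion hd.1))) _).comp
        (AdjoinRoot.lift ((AdjoinRoot.of (P.map (Subring.inclusion hd.1))).comp (Subring.inclusion hd.1))
          (AdjoinRoot.root (P.map (Subring.inclusion hd.1))) (eval₂_root_map_eq_zero (Subring.inclusion hd.1) P)))) :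
    Function.Injective g := by
  haveI := isLocalHom_inclusion_of_subringDominates hd
  haveI := isMaximal_ker_lift P ((φ'.comp (ResidueField.map (Subring.inclusion hd.1)))) θ
    (eval₂_inclusion_of_eval₂ hd P φ' θ hθ') hP
  haveI := isMaximal_ker_lift (P.map (Subring.inclusion hd.1)) φ' θ hθ' (hP.map _)
  -- separability upstairs
  have hsep' : ((P.map (Subring.inclusion hd.1)).map (residue S')).Separable := by
    have hfun : (residue S').comp (Subring.inclusion hd.1) = (ResidueField.map (Subring.inclusion hd.1)).comp (residue S) := by
      ext s
      change residue S' (Subring.inclusion hd.1 s) = ResidueField.map (Subring.inclusion hd.1) (residue S s)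
      rw [ResidueField.map_residue]
    have : (P.map (Subring.inclusion hd.1)).map (residue S') =
        (P.map (residue S)).map (ResidueField.map (Subring.inclusion hd.1)) := by
      rw [Polynomial.map_map, Polynomial.map_map, hfun]
    rw [this]
    exact hsep.map
  -- both localisations are regular, hence domains
  have hregT := isRegularLocalRing_localization_ker_lift P ((φ'.comp (ResidueField.map (Subring.inclusion hd.1)))) θ
    (eval₂_inclusion_of_eval₂ hd P φ' θ hθ') hreg hP hsep
  have hregT' := isRegularLocalRing_localization_ker_lift (P.map (Subring.inclusion hd.1)) φ' θ hθ' hreg' (hP.map _) hsep'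
  haveI := @isDomain_of_isRegularLocalRing _ _ hregT'
  let ι := AdjoinRoot.lift ((AdjoinRoot.of (P.map (Subring.inclusion hd.1))).comp (Subring.inclusion hd.1))
        (AdjoinRoot.root (P.map (Subring.inclusion hd.1))) (eval₂_root_map_eq_zero (Subring.inclusion hd.1) P)
  have hinj : Function.Injective (Subring.inclusion hd.1) := Subring.inclusion_injective hd.1
  have hk := ker_lift_eq_comap hd P φ' θ hθ'
  have key : ∀ (I : Ideal (AdjoinRoot P)) [I.IsPrime],
      RingHom.ker (AdjoinRoot.lift ((φ'.comp (ResidueField.map (Subring.inclusion hd.1))).comp (residue S)) θ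
        (eval₂_inclusion_of_eval₂ hd P φ' θ hθ')) = I → IsDomain (Localization.AtPrime I) := by
    intro I _ hI
    subst hI
    exact @isDomain_of_isRegularLocalRing _ _ hregT
  haveI : IsDomain (Localization.AtPrime ((RingHom.ker (AdjoinRoot.lift (φ'.comp (residue S')) θ hθ')).comap ι)) :=
    key _ hk
  exact localization_map_injective (Subring.inclusion hd.1) P hinj hP ι (lift_comp_of (Subring.inclusion hd.1) P)
    (RingHom.ker (AdjoinRoot.lift (φ'.comp (residue S')) θ hθ'))
    (injective_algebraMap_localization_ker_lift (P.map (Subring.inclusion hd.1)) φ' θ hθ' (hP.map _)) g hg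

omit [IsLocalRing S] in
/-- **The squares commute in `T′`**: `g (s read in T) = (incl s read in T′)` for any `g` over the change of rings `ι`. [folklore] -/
theorem liftHom_algebraMap (hP : P.Monic)
    (g : (haveI := isMaximal_ker_lift (P.map (Subring.inclusion hd.1)) φ' θ hθ' (hP.map _)
      Localization.AtPrime ((RingHom.ker (AdjoinRoot.lift (φ'.comp (residue S')) θ hθ')).comap
        (AdjoinRoot.lift ((AdjoinRoot.of (P.map (Subring.inclusion hd.1))).comp (Subring.inclusion hd.1))
          (AdjoinRoot.root (P.map (Subring.inclusion hd.1))) (eval₂_root_map_eq_zero (Subring.inclusion hd.1) P)))) →+*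
      (haveI := isMaximal_ker_lift (P.map (Subring.inclusion hd.1)) φ' θ hθ' (hP.map _)
      Localization.AtPrime (RingHom.ker (AdjoinRoot.lift (φ'.comp (residue S')) θ hθ'))))
    (hg : (haveI := isMaximal_ker_lift (P.map (Subring.inclusion hd.1)) φ' θ hθ' (hP.map _)
      g.comp (algebraMap (AdjoinRoot P) _) = (algebraMap (AdjoinRoot (P.map (Subring.inclusion hd.1))) _).comp
        (AdjoinRoot.lift ((AdjoinRoot.of (P.map (Subring.inclusion hd.1))).comp (Subring.inclusion hd.1))
          (AdjoinRoot.root (P.map (Subring.inclusion hd.1))) (eval₂_root_map_eq_zero (Subring.inclusion hd.1) P))))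
    (s : S) :
    haveI := isMaximal_ker_lift (P.map (Subring.inclusion hd.1)) φ' θ hθ' (hP.map _)
    g (algebraMap S _ s) = algebraMap S' _ (Subring.inclusion hd.1 s) := by
  haveI := isMaximal_ker_lift (P.map (Subring.inclusion hd.1)) φ' θ hθ' (hP.map _)
  have h1 := congrArg (fun F => F (AdjoinRoot.of P s)) hg
  simp only [RingHom.comp_apply, AdjoinRoot.lift_of] at h1
  rw [IsScalarTower.algebraMap_apply S (AdjoinRoot P) _, AdjoinRoot.algebraMap_eq, h1,
    IsScalarTower.algebraMap_apply S' (AdjoinRoot (P.map (Subring.inclusion hd.1))) _, AdjoinRoot.algebraMap_eq]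

omit [IsLocalRing S] in
/-- **The roots correspond**: `g (x read in T) = (x′ read in T′)`. [folklore] -/
theorem liftHom_root (hP : P.Monic)
    (g : (haveI := isMaximal_ker_lift (P.map (Subring.inclusion hd.1)) φ' θ hθ' (hP.map _)
      Localization.AtPrime ((RingHom.ker (AdjoinRoot.lift (φ'.comp (residue S')) θ hθ')).comap
        (AdjoinRoot.lift ((AdjoinRoot.of (P.map (Subring.inclusion hd.1))).comp (Subring.inclusion hd.1))
          (AdjoinRoot.root (P.map (Subring.inclusion hd.1))) (eval₂_root_map_eq_zero (Subring.inclusion hd.1) P)))) →+*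
      (haveI := isMaximal_ker_lift (P.map (Subring.inclusion hd.1)) φ' θ hθ' (hP.map _)
      Localization.AtPrime (RingHom.ker (AdjoinRoot.lift (φ'.comp (residue S')) θ hθ'))))
    (hg : (haveI := isMaximal_ker_lift (P.map (Subring.inclusion hd.1)) φ' θ hθ' (hP.map _)
      g.comp (algebraMap (AdjoinRoot P) _) = (algebraMap (AdjoinRoot (P.map (Subring.inclusion hd.1))) _).comp
        (AdjoinRoot.lift ((AdjoinRoot.of (P.map (Subring.inclusion hd.1))).comp (Subring.inclusion hd.1))
          (AdjoinRoot.root (P.map (Subring.inclusion hd.1))) (eval₂_root_map_eq_zero (Subring.inclusion hd.1) P)))) :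
    haveI := isMaximal_ker_lift (P.map (Subring.inclusion hd.1)) φ' θ hθ' (hP.map _)
    g (algebraMap (AdjoinRoot P) _ (AdjoinRoot.root P)) =
      algebraMap (AdjoinRoot (P.map (Subring.inclusion hd.1))) _ (AdjoinRoot.root (P.map (Subring.inclusion hd.1))) := by
  haveI := isMaximal_ker_lift (P.map (Subring.inclusion hd.1)) φ' θ hθ' (hP.map _)
  have h1 := congrArg (fun F => F (AdjoinRoot.root P)) hg
  simp only [RingHom.comp_apply, AdjoinRoot.lift_root] at h1
  exact h1

end TwoLevels

end Summit.ResolutionOfSingularities.ResolutionOfSingularities.Theorems.SwitchingDichotomy.EtaleLift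

end
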